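import Literature.MathematicalPhysics.QuantumFieldTheory.BalabanImbrieJaffe1984to88.BIJ88Eq242HiggsCovarianceTorus
import Literature.MathematicalPhysics.QuantumFieldTheory.BalabanImbrieJaffe1984to88.BIJ88WalkGaugeCovariance
import Literature.MathematicalPhysics.QuantumFieldTheory.BalabanImbrieJaffe1984to88.BIJ88BgInvariance416Torus

/-!
# `BalabanImbrieJaffe1984to88.BIJ88Claim265GaugeTransfTorus` — T. Bałaban, J. Imbrie, A. Jaffe, *Effective action and cluster properties of
the abelian Higgs model*, Commun. Math. Phys. **114** (1988) 257–315 [BalabanImbrieJaffe1988], §2 p. 265 [PDF 9], the sentence after (2.48):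
**«Note that all operators introduced through random walk expansions of C^{(k)}_Λ(u) or G_k(Ω, u) transform properly under gauge
transformations, that is, by the difference of the gauge transformation between the points of evaluation of the kernel.»  FOR THE MODEL'S
COVARIANCE `C^{(k)}_Λ(u) = [(Δ_{k,loc}(u) + κP(ū_k))|_Λ]^{−1}` ON THE TORUS** — the walk terms `C^{(k)}_{Λ,ω}(u)` of (2.42), the local part
`C^{(k)}_{Λ,loc}(u)` (2.43), the parts `C^{(k)}_{Λ,X}(u)` (2.44) and `C^{(k)}_Λ(u)` itself, as gen 23's charted objects (`BIJ88Eq242HiggsCovarianceTorus`: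
`reOp`, p13's `latticeCw` / `cLoc` / `cX` read through `idxEquiv`), in p13's real «sandwich» form AND in complex form
`K[u^h](x₁, x₂) = h(x₁) · K[u](x₁, x₂) · h(x₂)^{−1}`.

p13's `BIJ88WalkGaugeCovariance` (p253697, row C2.Claim@265 `proved`) proves the sentence for the `ℤ^d` operators of [6] =
[Balaban1983RegularityDecay] Sect. 5 and records in its HONEST SCOPE: *«that the print's operator `Δ_{k,loc}(u) + aL^{−2}Q(u)*Q(u)` of (2.40) at
the transformed background `u^λ` IS the conjugate `𝒢_λ(·)𝒢_λᵀ` of the one at `u` is the model's input …, displayed here as the hypothesis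
"`A′ = 𝒢A𝒢ᵀ`", not proved.»*  THIS FILE DISCHARGES THAT HYPOTHESIS for the model's operator of record (p34's `prec49` = gen 15/18's
`op240 (deltaLocT …) κ (ū_k)`; `reOp_prec49_gaugeAct`) and carries p13's theorems over to the torus objects.

statement-level skeleton of published theorems with citation tags; proofs where landed; nothing here is a claim about the Yang–Mills mass gap

PDF held: `paper:balaban1988-cmp114-bij-abelian-higgs-effective-action` (journal page = PDF page + 256); p. 265 = PDF 9 re-read this session
(`lit read … --pages 8-9`, text layer `p0009.txt` l. 8–10 = the sentence quoted above, verbatim).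

CITATION HEADER (lean-in-tree rule).  lit-balaban cell (HOME `run/shared/lean/pub/lit-balaban/`), Phase 2, proof seat **p31 gen 25** (unit
`lit-balaban-p31`, literature-prover-lit-balaban-p31-g25-0), free-target protocol G.5-34(d), TAKING #1 line HOME/STATUS.md 2026-08-23T20:18:05Z
(objection window 20 min; stem check `265|WalkGauge|GaugeTransf` = p13's `BIJ88WalkGaugeCovariance` only; cc r18, p13, p34).  Row of
`HOME/lit-balaban-r18/ROWS-C2.md` served: **C2.Claim@265** (head `proved p253697` UNCHANGED; LOCATED MEMBER «for the model's C^{(k)}_Λ(u) on the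
torus» — the cell's «model instance: the ℤ^d operators of [6] Sect. 5» widened to the model's operator; cells only), with cells C2.Eq2.42 /
2.43 / 2.44 / 2.40 (complex forms of the walk pieces).  Files USED BY NAME, nothing restated: p13 `BIJ88WalkGaugeCovariance` (`gconj`, `sandwich`,
`gconj_apply`, `gconj_latticeCw`, `cLoc_gauge`, `cX_gauge`, `hyp56_gconj`, `B4GaugeCovariance.IsGauge`/`blockDiag`), gen 23
`BIJ88Eq242HiggsCovarianceTorus` (`chartSet`, `chartEquiv`, `idxEquiv`, `reOp`, `hasSum_walkTerms_inv`), p13 `BIJ88Eq242Lattice.latticeCw`,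
`BIJ88RandomWalk242.{Walk, cLoc, cX}`, `BIJ88Ineq246Lattice.{ldist, cubeOf, touch, Cubes}`, `B4Sect5CubeBounds.{labels, kR, thetaConst}`, `B4.Hyp56`;
gen 18/19 `BIJ88Eq240FlatTorus.{realify, compress, op240}` / `BIJ88Decay241FlatTorus.{realify_mul, realify_one}`; p34 `BIJ88BgInvariance416Torus`
(`prec49`, **`prec49_gaugeAct`** = the (4.16) identity `H(u^h) = M^{(k)}_h H(u) M^{(k)}_hᴴ` from gen 15's `deltaLocT_gaugeAct` and p11's (2.8),
`compress_diagonal_sandwich`, `realify_conjTranspose`); gen 15 `BIJ88DeltaLoc234Torus.{mulOpK, deltaLocT}`; `BIJ88Sect3Statements.{toC, norm_toC,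
toC_mul, toC_inv}`.

## What is proved (0 `sorry`; axioms `propext`, `Classical.choice`, `Quot.sound`)

* §1 `rot z` — multiplication by `z ∈ ℂ` on `ℂ ≅ ℝ²` as a real `2 × 2` matrix (the block pattern of gen 18's `realify`: `realify_apply_rot`);
  ring-map facts `rot_mul` / `rot_one` / `rot_zero` / `rot_conj` (`conj ↦ ᵀ`) / `rot_transpose_mul_self` (`= |z|²·1`), and **`U(1)` phases are
  orthogonal blocks** (`rot_transpose_mul_self_of_norm`).
* §2 `rotG Λ d` — the block family `y ↦ rot (d x)` on the charted `Λ′ ⊂ ℤ^d` (`x` = the site of `Λ` charted to `y`); `isGauge_rotG` (p13's `IsGauge`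
  for unit phases); `reindex_realify_diagonal` (the charted realification of `diag(d)|_Λ` IS p13's `blockDiag (rotG Λ d)`); **THE KEY IDENTITY
  `reOp_diagonal_sandwich`: `reOp Λ (D H Dᴴ) = gconj (rotG Λ d) (reOp Λ H)` for EVERY diagonal `D = diag(d)` and every `H`** (restriction commutes
  with sitewise conjugation, `realify` is multiplicative and turns `ᴴ` into `ᵀ`); `gconj_rotI_reOp` (the charted operator is invariant under the
  constant block `J = rot i` — it is complex-linear), `isGauge_rotI`.
* §3 `cplxK Λ K x₁ x₂` — the complex number carried by a real kernel on `Λ × {Re, Im}` (gen 23's «first column» reading); `apply_eq_rot_cplxK_of_rotI`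
  (**`J`-invariant kernels have `rot` blocks**), `sandwich_eq_mul` (p13's `sandwich` = the block product `g(x₁)K(x₁,x₂)g(x₂)ᵀ`),
  **`sandwich_rotG_apply_of_rotI` / `cplxK_sandwich_rotG_of_rotI`: the conjugate of a `J`-invariant kernel by unit phases has the blocks
  `rot (d(x₁) · K^ℂ(x₁,x₂) · conj d(x₂))`** — the printed «difference of the gauge transformation between the points of evaluation».
* §4 THE WALK TERMS of (2.42) for `C = (H|_Λ)^{−1}`, ANY `H`, ANY `Λ ⊆ T^{(k)}` (wrapping or not), ANY cube size `M`, ANY walk `ω`, no (5.6):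
  **`latticeCw_reOp_sandwich`** (`C_ω[(DHDᴴ)|_Λ] = gconj (rotG Λ d) (C_ω[H|_Λ])`, p13's `gconj_latticeCw` on §2) / `_apply`;
  `sandwich_rotI_latticeCw_reOp` (the walk terms are `J`-invariant); `walkC` (the complex walk term `C^ℂ_ω(x₁,x₂)`) with
  `latticeCw_reOp_apply_eq_rot` (**the real walk term IS `rot (C^ℂ_ω)` blockwise** — gen 23's reading loses nothing), `hasSum_walkC` (gen 23's (2.42)
  `C(x₁,x₂) = Σ_ω C^ℂ_ω(x₁,x₂)` restated), and **`walkC_sandwich`: `C^ℂ_ω[(DHDᴴ)|_Λ](x₁,x₂) = d(x₁)·C^ℂ_ω[H|_Λ](x₁,x₂)·conj d(x₂)`**.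
* §5 THE RESUMMED PIECES under [6] (5.6) for the charted `H|_Λ` + p13's cube conditions `M ≥ 5`, `M > K_R`, `M > Θ₁` (absolute convergence):
  `locK`/`regK` (p13's `cLoc`/`cX` of the charted walk terms = gen 23's objects) with **`locK_sandwich`** / **`regK_sandwich`** (p13's
  `cLoc_gauge`/`cX_gauge` BY NAME), `sandwich_rotI_locK/regK` (`J`-invariance), `locC`/`regC` (complex readings) with `locK/regK_apply_eq_rot` and
  **`locC_sandwich` / `regC_sandwich`** (complex form of the sentence for (2.43)/(2.44)); `eq245_cplx` (**(2.45) in complex form**: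
  `C(x₁,x₂) = C^ℂ_{Λ,loc}(x₁,x₂) + Σ_X C^ℂ_{Λ,X}(x₁,x₂)`, gen 23's `eq245_realify_inv` read in `ℂ`); the full covariance WITHOUT any hypothesis:
  **`inv_compress_diagonal_sandwich`** (`[(DHDᴴ)|_Λ]^{−1} = D_Λ[H|_Λ]^{−1}D_Λᴴ`) / `_apply`; `hyp56_reOp_diagonal_sandwich` ((5.6) transports along the
  orbit with `c₀ ↦ 4c₀`, p13's `hyp56_gconj`).
* §6 THE MODEL `H(u) = prec49 a c U k cube λ ζ″ κ` on `ℓ²(T₁^{(k)})`, `u ↦ u^h`, phases `h(cornerIter k x)` at the points of evaluation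
  `x ∈ Λ ⊆ T₁^{(k)}` ([BalabanImbrieJaffe1985] (2.8)): **`reOp_prec49_gaugeAct`** (p13's displayed hypothesis DISCHARGED: `reOp Λ (H(u^h)) =
  gconj (rotG Λ (toC ∘ h ∘ cornerIter k)) (reOp Λ (H(u)))`), **`latticeCw_prec49_gaugeAct`** (the model's walk terms, termwise, no (5.6)),
  **`walkC_prec49_gaugeAct`** / `…'` (`C^ℂ_ω[u^h](x₁,x₂) = h(x₁)·C^ℂ_ω[u](x₁,x₂)·conj h(x₂) = (h(x₁)h(x₂)^{−1})·C^ℂ_ω[u](x₁,x₂)`),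
  **`locK_regK_prec49_gaugeAct`** / **`locC_regC_prec49_gaugeAct`** (local part and `X`-parts, under (5.6) for `reOp Λ (H(u))`),
  **`inv_compress_prec49_gaugeAct_apply`** (`C^{(k)}_Λ(u^h; x₁,x₂) = h(x₁)·C^{(k)}_Λ(u; x₁,x₂)·conj h(x₂)`, no hypothesis),
  `hyp56_reOp_prec49_gaugeAct`; COROLLARIES `norm_walkC_prec49_gaugeAct` / `norm_locC_regC_prec49_gaugeAct` (the SIZES of the walk pieces and of
  `C^{(k)}_Λ(u; x₁,x₂)` are gauge invariant — the bounds (2.41)/(2.43)/(2.46)/(2.47) are statements about the gauge orbit).  Standing data of §6: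
  cube family of `k`-block unions, `a > 0`, `c ≠ 0`, `j + k + 1 ≤ m + K` (p34's).
* §7 THE USE OF THE SENTENCE (cf. p. 287 *«all terms are gauge invariant»*): **`form_walkC_prec49_gaugeAct`** / **`form_locC_regC_prec49_gaugeAct`** —
  the bilinear forms `Σ conj ψ(x₁) K(x₁,x₂) φ(x₂)` of the model's `C^ℂ_ω(u)`, `C^{(k)}_Λ(u)` (no (5.6)) and `C^ℂ_{Λ,loc}(u)`, `C^ℂ_{Λ,X}(u)` (under (5.6))
  are INVARIANT under `(u, ψ, φ) ↦ (u^h, hψ, hφ)`.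

HONEST SCOPE / DIVERGENCE.  (i) The sentence's `G_k(Ω, u)` half (the operators of [6] §2's expansion (2.13) of the Neumann propagators) is NOT
instantiated: the tree has gen 15's `gBox` = `G_k(Ω,u)` with its gauge covariance (`gBox_gaugeAct`) but no torus walk pieces of it (p31 g16's decay
inputs come from pub-balaban's B4 torus/box theorems by name, not from a walk expansion of `gBox`).  (ii) The resummed members (§5, §6) carry [6]
(5.6) for the charted `H(u)|_Λ` as a displayed hypothesis (p13's `cLoc_gauge`/`cX_gauge` need absolute convergence); it is INHABITED for this
operator by gen 23's `BIJ88Eq242HiggsCovarianceTorusCwt.hyp56_deltaLocT_smallPlaquette_torus_cwt` (small-plaquette background, printed torus data),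
`hyp56_deltaLocT_gen`, and `BIJ88Eq242HiggsCovarianceActualBackground.hyp56_deltaLocT_actualBg` — all in p11's `lineIter U k` currency, which IS
p34's `barUc k U` by p30's `BIJ88Eq44CornerCentre.barUc_eq_lineIter` (not imported here: that module is behind the farm's build queue at filing
time; the rewrite is one line for a consumer).  The termwise members (§4, §6 walk terms) and the full covariance need NO hypothesis.  (iii) Complex
reading = gen 23's (first column of the `2 × 2` block), justified here by the `J`-structure lemmas; the u-LOCALITY clauses are gen 23's
`BIJ88DeltaLocULocalityTorus` and are not restated.  (iv) Eight small `def`s with bodies (`rot`, `rotG`, `cplxK`, `walkC`, `locK`, `regK`, `locC`,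
`regC`), no `def … : Prop` fact, no `sorry` (D-0026).  Imports: gen 23 `BIJ88Eq242HiggsCovarianceTorus`, p13 `BIJ88WalkGaugeCovariance`, p34
`BIJ88BgInvariance416Torus`.  Literature + Mathlib only.  Unit `lit-balaban-p31` (literature-prover-lit-balaban-p31-g25-0), 2026-08-23.  NOT summit
progress.
-/

open scoped BigOperators Matrix ComplexConjugate
open Finset Matrix

namespace Literature.MathematicalPhysics.QuantumFieldTheory.BalabanImbrieJaffe1984to88.BIJ88Claim265GaugeTransfTorus

open Literature.MathematicalPhysics.QuantumFieldTheory.Balaban1983to89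
open BIJ88Sect3Statements (U1 toC norm_toC)
open GaugeField (gaugeAct)
open BIJ85BlockAveragesTorus BIJ85BlockAveragesTorusK
open BIJ88Eq240FlatTorus (realify compress op240 pOp)
open BIJ88Decay241FlatTorus (realify_mul realify_one realify_apply_fst realify_apply_snd realify_inv)
open BIJ88BgInvariance416Torus (realify_conjTranspose compress_diagonal_sandwich conjTranspose_mul_diagonal_toC prec49 prec49_gaugeAct)
open BIJ88DeltaLoc234Torus (mulOpK deltaLocT)
open BIJ88NeumannNoZeroModesTorus (IsBlockUnion)
open B4GaugeCovariance (IsGauge blockOp blockOp_apply)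
open BIJ88RandomWalk242 BIJ88Eq242Lattice BIJ88Ineq246Lattice B4Sect5CubeBounds
open BIJ88WalkGaugeCovariance (gconj sandwich gconj_apply gconj_latticeCw cLoc_gauge cX_gauge inv_gauge_apply hyp56_gconj)
open BIJ88Eq242HiggsCovarianceTorus

noncomputable section

variable {P : Params} {j : ℕ}

/-! ## §1 Multiplication by a complex number as a real `2 × 2` matrix; `U(1)` phases are p13's gauge blocks -/

section Rot

/-- **Multiplication by `z ∈ ℂ` on `ℂ ≅ ℝ²`** as the real `2 × 2` matrix `[[Re z, −Im z], [Im z, Re z]]` — the `2 × 2` block pattern of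
gen 18's realification `realify`; for a `U(1)` phase `z = e^{ie_kλ(x)}` this is the rotation p13's `BIJ88WalkGaugeCovariance` names as the
gauge block of the abelian Higgs model (*"the rotation of ℂ ≅ ℝ² by the angle e_kλ(x)"*).
[cite: BalabanImbrieJaffe1988, p.265 (gauge covariance of the random walk operators)] -/
def rot (z : ℂ) : Matrix (Fin 2) (Fin 2) ℝ :=
  Matrix.of fun a b => if a = 0 then (if b = 0 then z.re else -z.im) else (if b = 0 then z.im else z.re)

/-- kernel: the four entries. [cite: BalabanImbrieJaffe1988, p.265 (gauge covariance of the random walk operators)] -/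
@[simp] theorem rot_apply_00 (z : ℂ) : rot z 0 0 = z.re := rfl
/-- kernel. [cite: BalabanImbrieJaffe1988, p.265 (gauge covariance of the random walk operators)] -/
@[simp] theorem rot_apply_01 (z : ℂ) : rot z 0 1 = -z.im := rfl
/-- kernel. [cite: BalabanImbrieJaffe1988, p.265 (gauge covariance of the random walk operators)] -/
@[simp] theorem rot_apply_10 (z : ℂ) : rot z 1 0 = z.im := rfl
/-- kernel. [cite: BalabanImbrieJaffe1988, p.265 (gauge covariance of the random walk operators)] -/
@[simp] theorem rot_apply_11 (z : ℂ) : rot z 1 1 = z.re := rfl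

/-- kernel: the realification IS the family of `rot` blocks: `realify M ((i,a),(k,b)) = rot (M i k) a b`.
[cite: BalabanImbrieJaffe1988, (2.40) p.264] -/
theorem realify_apply_rot {ι : Type*} [Fintype ι] [DecidableEq ι] (M : Matrix ι ι ℂ) (i k : ι) (a b : Fin 2) :
    realify M (i, a) (k, b) = rot (M i k) a b := rfl

/-- `rot` is multiplicative (`ℂ → M₂(ℝ)` is a ring map). [cite: BalabanImbrieJaffe1988, p.265 (gauge covariance of the random walk operators)] -/
theorem rot_mul (z w : ℂ) : rot (z * w) = rot z * rot w := by
  ext a b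
  fin_cases a <;> fin_cases b <;> simp [rot, Matrix.mul_apply, Fin.sum_univ_two] <;> ring

/-- `rot 1 = 1`. [cite: BalabanImbrieJaffe1988, p.265 (gauge covariance of the random walk operators)] -/
theorem rot_one : rot 1 = 1 := by
  ext a b
  fin_cases a <;> fin_cases b <;> simp [rot]

/-- `rot 0 = 0`. [cite: BalabanImbrieJaffe1988, p.265 (gauge covariance of the random walk operators)] -/
theorem rot_zero : rot 0 = 0 := by
  ext a b
  fin_cases a <;> fin_cases b <;> simp [rot]

/-- complex conjugation is transposition: `rot (conj z) = (rot z)ᵀ`. [cite: BalabanImbrieJaffe1988, p.265 (gauge covariance of the random walk operators)] -/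
theorem rot_conj (z : ℂ) : rot (conj z) = (rot z)ᵀ := by
  ext a b
  fin_cases a <;> fin_cases b <;> simp [rot]

/-- `(rot z)ᵀ · rot z = |z|² · 1`. [cite: BalabanImbrieJaffe1988, p.265 (gauge covariance of the random walk operators)] -/
theorem rot_transpose_mul_self (z : ℂ) : (rot z)ᵀ * rot z = (Complex.normSq z) • (1 : Matrix (Fin 2) (Fin 2) ℝ) := by
  ext a b
  fin_cases a <;> fin_cases b <;> simp [rot, Matrix.mul_apply, Fin.sum_univ_two, Complex.normSq_apply] <;> ring

/-- **a `U(1)` phase is an orthogonal block** (p13's `IsGauge` pointwise): `‖z‖ = 1 ⇒ (rot z)ᵀ · rot z = 1`.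
[cite: BalabanImbrieJaffe1988, p.265 (gauge covariance of the random walk operators)] -/
theorem rot_transpose_mul_self_of_norm {z : ℂ} (hz : ‖z‖ = 1) : (rot z)ᵀ * rot z = 1 := by
  rw [rot_transpose_mul_self, Complex.normSq_eq_norm_sq, hz, one_pow, one_smul]

/-- the complex number is recovered from the first column of its block. [cite: BalabanImbrieJaffe1988, p.265 (gauge covariance of the random walk operators)] -/
theorem mk_rot_col (z : ℂ) : (⟨rot z 0 0, rot z 1 0⟩ : ℂ) = z := Complex.ext rfl rfl

end Rot

/-! ## §2 The charted gauge block family and THE KEY IDENTITY `reOp Λ (D H Dᴴ) = 𝒢 · reOp Λ H · 𝒢ᵀ` -/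

section Key

variable {Λ : Finset (Balaban1983to89.Site P j)}

/-- **The gauge block family on the charted region**: the site `y ∈ Λ′ ⊂ ℤ^d` (chart of `x ∈ Λ ⊆ T^{(k)}`) carries the block `rot (d x)`
(`d x` = the phase of the gauge transformation at the point of evaluation `x`). [cite: BalabanImbrieJaffe1988, p.265 (gauge covariance of the random walk operators)] -/
def rotG (Λ : Finset (Balaban1983to89.Site P j)) (d : Balaban1983to89.Site P j → ℂ) : ↥(chartSet Λ) → Matrix (Fin 2) (Fin 2) ℝ :=
  fun y => rot (d ((chartEquiv Λ).symm y).1)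

/-- kernel: at the chart of `x` the block is `rot (d x)`. [cite: BalabanImbrieJaffe1988, p.265 (gauge covariance of the random walk operators)] -/
@[simp] theorem rotG_chartEquiv (d : Balaban1983to89.Site P j → ℂ) (x : ↥Λ) : rotG Λ d (chartEquiv Λ x) = rot (d x.1) := by
  simp [rotG]

/-- **`U(1)` phases form a gauge transformation in p13's sense** (`B4GaugeCovariance.IsGauge`: every block orthogonal).
[cite: BalabanImbrieJaffe1988, p.265 (gauge covariance of the random walk operators)] -/
theorem isGauge_rotG {d : Balaban1983to89.Site P j → ℂ} (hd : ∀ x ∈ Λ, ‖d x‖ = 1) : IsGauge (rotG Λ d) :=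
  fun y => rot_transpose_mul_self_of_norm (hd _ ((chartEquiv Λ).symm y).2)

/-- kernel: the charted realification of the diagonal `diag(d)|_Λ` IS p13's block-diagonal operator `B4GaugeCovariance.blockDiag (rotG Λ d)`.
[cite: BalabanImbrieJaffe1988, p.265 (gauge covariance of the random walk operators)] -/
theorem reindex_realify_diagonal (d : Balaban1983to89.Site P j → ℂ) :
    Matrix.reindex (idxEquiv Λ) (idxEquiv Λ) (realify (diagonal fun x : ↥Λ => d x.1)) = B4GaugeCovariance.blockDiag (rotG Λ d) := by
  ext p q
  obtain ⟨p', rfl⟩ := (idxEquiv Λ).surjective p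
  obtain ⟨q', rfl⟩ := (idxEquiv Λ).surjective q
  obtain ⟨x, a⟩ := p'
  obtain ⟨y, b⟩ := q'
  rw [Matrix.reindex_apply, Matrix.submatrix_apply, Equiv.symm_apply_apply, Equiv.symm_apply_apply, realify_apply_rot,
    B4GaugeCovariance.blockDiag, blockOp_apply]
  simp only [idxEquiv, Equiv.prodCongr_apply, Prod.map_apply, Equiv.refl_apply, EmbeddingLike.apply_eq_iff_eq, rotG_chartEquiv]
  by_cases hxy : x = y
  · subst hxy
    simp
  · rw [diagonal_apply_ne _ hxy, if_neg hxy, rot_zero]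

/-- kernel: `reOp` unfolded. [cite: BalabanImbrieJaffe1988, (2.40) p.264] -/
private theorem reOp_eq (H : Matrix (Balaban1983to89.Site P j) (Balaban1983to89.Site P j) ℂ) :
    reOp Λ H = Matrix.reindex (idxEquiv Λ) (idxEquiv Λ) (realify (compress Λ H)) := rfl

/-- kernel: re-indexing along an equivalence is multiplicative. [folklore] (bookkeeping for Bałaban–Imbrie–Jaffe, CMP **114**, p. 265) -/
private theorem reindex_mul {m n : Type*} [Fintype m] [Fintype n] (e : m ≃ n) (A B : Matrix m m ℝ) :
    Matrix.reindex e e (A * B) = Matrix.reindex e e A * Matrix.reindex e e B := by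
  simp only [Matrix.reindex_apply]
  rw [Matrix.submatrix_mul_equiv]

/-- kernel: re-indexing commutes with transposition. [folklore] (bookkeeping for Bałaban–Imbrie–Jaffe, CMP **114**, p. 265) -/
private theorem reindex_transpose {m n : Type*} (e : m ≃ n) (A : Matrix m m ℝ) :
    Matrix.reindex e e Aᵀ = (Matrix.reindex e e A)ᵀ := by
  simp only [Matrix.reindex_apply, Matrix.transpose_submatrix]

/-- **THE KEY IDENTITY (p13's displayed hypothesis `A′ = 𝒢A𝒢ᵀ` for charted torus operators)**: for every diagonal `D = diag(d)` on
`ℓ²(T^{(k)})` and every operator `H`, the charted real operator of the conjugate `D H Dᴴ` restricted to `Λ` is the gauge conjugate (p13's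
`gconj`) of the charted real operator of `H|_Λ` by the block family `rot ∘ d` — restriction commutes with the sitewise conjugation, the
realification is multiplicative and turns `ᴴ` into `ᵀ`. (No hypothesis on `d`: an algebraic identity.)
[cite: BalabanImbrieJaffe1988, p.265 (gauge covariance of the random walk operators)] -/
theorem reOp_diagonal_sandwich (d : Balaban1983to89.Site P j → ℂ) (H : Matrix (Balaban1983to89.Site P j) (Balaban1983to89.Site P j) ℂ) :
    reOp Λ (diagonal d * H * (diagonal d)ᴴ) = gconj (rotG Λ d) (reOp Λ H) := by
  rw [reOp_eq, reOp_eq, compress_diagonal_sandwich, realify_mul, realify_mul, realify_conjTranspose, reindex_mul, reindex_mul,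
    reindex_transpose, reindex_realify_diagonal]
  rfl

/-- kernel: the entries of a diagonal sandwich. [folklore] (bookkeeping for Bałaban–Imbrie–Jaffe, CMP **114**, p. 265) -/
private theorem diagonal_sandwich_apply {n : Type*} [Fintype n] [DecidableEq n] (d : n → ℂ) (B : Matrix n n ℂ) (i l : n) :
    (diagonal d * B * (diagonal d)ᴴ) i l = d i * B i l * conj (d l) := by
  rw [diagonal_conjTranspose, mul_diagonal, diagonal_mul, Pi.star_apply, Complex.star_def]

/-- kernel: conjugation by the constant phase `i` is trivial: `diag(i) H diag(i)ᴴ = H`. [folklore] (bookkeeping for Bałaban–Imbrie–Jaffe, CMP **114**, p. 265) -/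
private theorem diagonal_I_sandwich (H : Matrix (Balaban1983to89.Site P j) (Balaban1983to89.Site P j) ℂ) :
    diagonal (fun _ : Balaban1983to89.Site P j => Complex.I) * H * (diagonal fun _ : Balaban1983to89.Site P j => Complex.I)ᴴ = H := by
  ext i l
  rw [diagonal_sandwich_apply, Complex.conj_I]
  ring_nf
  rw [Complex.I_sq]
  ring

/-- **THE `J`-STRUCTURE OF A CHARTED TORUS OPERATOR**: `reOp Λ H` is invariant under p13's conjugation by the constant block `J = rot i`
(multiplication by `i`) — it is the realification of a complex-linear operator. [cite: BalabanImbrieJaffe1988, (2.40) p.264] -/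
theorem gconj_rotI_reOp (H : Matrix (Balaban1983to89.Site P j) (Balaban1983to89.Site P j) ℂ) :
    gconj (rotG Λ fun _ => Complex.I) (reOp Λ H) = reOp Λ H := by
  rw [← reOp_diagonal_sandwich, diagonal_I_sandwich]

/-- kernel: the constant phase `i` is a gauge transformation. [cite: BalabanImbrieJaffe1988, p.265 (gauge covariance of the random walk operators)] -/
theorem isGauge_rotI : IsGauge (rotG Λ fun _ : Balaban1983to89.Site P j => Complex.I) :=
  isGauge_rotG fun x _ => by simp

end Key

/-! ## §3 Reading a real kernel on `Λ × {Re, Im}` as a complex kernel; `J`-invariance ⇒ the blocks are `rot` of one complex number -/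

section Cplx

variable {Λ : Finset (Balaban1983to89.Site P j)}

/-- **The complex kernel carried by a real kernel on the charted `Λ × {Re, Im}`** — gen 23's «first column» reading (`hasSum_walkTerms_inv`):
`K^ℂ(x₁, x₂) := K((x₁,Re),(x₂,Re)) + i·K((x₁,Im),(x₂,Re))`. [cite: BalabanImbrieJaffe1988, (2.42) p.264] -/
def cplxK (Λ : Finset (Balaban1983to89.Site P j)) (K : B4.Idx (chartSet Λ) 2 → B4.Idx (chartSet Λ) 2 → ℝ) (x₁ x₂ : ↥Λ) : ℂ :=
  ⟨K (idxEquiv Λ (x₁, 0)) (idxEquiv Λ (x₂, 0)), K (idxEquiv Λ (x₁, 1)) (idxEquiv Λ (x₂, 0))⟩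

/-- **`J`-invariant kernels have `rot` blocks**: if `K` is invariant under p13's conjugation by the constant block `rot i`, then its `2 × 2`
block at `(x₁, x₂)` is `rot (K^ℂ(x₁, x₂))` — every real kernel produced from `reOp Λ H` by conjugation-equivariant operations is the
realification pattern of its complex kernel. [cite: BalabanImbrieJaffe1988, p.265 (gauge covariance of the random walk operators)] -/
theorem apply_eq_rot_cplxK_of_rotI {K : B4.Idx (chartSet Λ) 2 → B4.Idx (chartSet Λ) 2 → ℝ}
    (hK : ∀ p q, sandwich (rotG Λ fun _ => Complex.I) K p q = K p q) (x₁ x₂ : ↥Λ) (a b : Fin 2) :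
    K (idxEquiv Λ (x₁, a)) (idxEquiv Λ (x₂, b)) = rot (cplxK Λ K x₁ x₂) a b := by
  have h00 := hK (idxEquiv Λ (x₁, 0)) (idxEquiv Λ (x₂, 0))
  have h01 := hK (idxEquiv Λ (x₁, 0)) (idxEquiv Λ (x₂, 1))
  simp only [sandwich, idxEquiv, Equiv.prodCongr_apply, Prod.map_apply, Equiv.refl_apply, rotG_chartEquiv, Fin.sum_univ_two,
    rot_apply_00, rot_apply_01, rot_apply_10, rot_apply_11, Complex.I_re, Complex.I_im] at h00 h01
  fin_cases a <;> fin_cases b <;>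
    simp only [cplxK, idxEquiv, Equiv.prodCongr_apply, Prod.map_apply, Equiv.refl_apply, Fin.zero_eta, Fin.mk_one, Fin.isValue,
      rot_apply_00, rot_apply_01, rot_apply_10, rot_apply_11] <;> linarith

/-- kernel: p13's `sandwich` is the block product `g(x₁) · K(x₁,x₂) · g(x₂)ᵀ` read entrywise. [cite: BalabanImbrieJaffe1988, p.265 (gauge covariance of the random walk operators)] -/
theorem sandwich_eq_mul (g : ↥(chartSet Λ) → Matrix (Fin 2) (Fin 2) ℝ) (K : B4.Idx (chartSet Λ) 2 → B4.Idx (chartSet Λ) 2 → ℝ)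
    (p q : B4.Idx (chartSet Λ) 2) :
    sandwich g K p q = (g p.1 * (Matrix.of fun i l => K (p.1, i) (q.1, l)) * (g q.1)ᵀ) p.2 q.2 := by
  simp only [sandwich, Matrix.mul_apply, Matrix.transpose_apply, Matrix.of_apply, Finset.sum_mul]

/-- **THE PRINTED SENTENCE AS A FORMULA**: if `K` has `rot` blocks, the gauge conjugate by the phases `d` has the blocks
`rot (d(x₁) · K^ℂ(x₁,x₂) · conj d(x₂))` — *"by the difference of the gauge transformation between the points of evaluation of the kernel"*
(for `d = e^{ie_kλ}`: the phase `e^{ie_k(λ(x₁) − λ(x₂))}`). [cite: BalabanImbrieJaffe1988, p.265 (gauge covariance of the random walk operators)] -/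
theorem sandwich_rotG_apply_of_rotI {K : B4.Idx (chartSet Λ) 2 → B4.Idx (chartSet Λ) 2 → ℝ}
    (hK : ∀ p q, sandwich (rotG Λ fun _ => Complex.I) K p q = K p q) (d : Balaban1983to89.Site P j → ℂ) (x₁ x₂ : ↥Λ) (a b : Fin 2) :
    sandwich (rotG Λ d) K (idxEquiv Λ (x₁, a)) (idxEquiv Λ (x₂, b)) = rot (d x₁.1 * cplxK Λ K x₁ x₂ * conj (d x₂.1)) a b := by
  rw [sandwich_eq_mul, rot_mul, rot_mul, rot_conj]
  have hblock : (Matrix.of fun i l => K ((idxEquiv Λ (x₁, a)).1, i) ((idxEquiv Λ (x₂, b)).1, l)) = rot (cplxK Λ K x₁ x₂) := by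
    ext i l
    rw [Matrix.of_apply]
    exact apply_eq_rot_cplxK_of_rotI hK x₁ x₂ i l
  rw [hblock]
  simp [idxEquiv]

/-- **complex form**: the complex kernel of the conjugate is `d(x₁) · K^ℂ(x₁,x₂) · conj d(x₂)`.
[cite: BalabanImbrieJaffe1988, p.265 (gauge covariance of the random walk operators)] -/
theorem cplxK_sandwich_rotG_of_rotI {K : B4.Idx (chartSet Λ) 2 → B4.Idx (chartSet Λ) 2 → ℝ}
    (hK : ∀ p q, sandwich (rotG Λ fun _ => Complex.I) K p q = K p q) (d : Balaban1983to89.Site P j → ℂ) (x₁ x₂ : ↥Λ) :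
    cplxK Λ (sandwich (rotG Λ d) K) x₁ x₂ = d x₁.1 * cplxK Λ K x₁ x₂ * conj (d x₂.1) := by
  have h0 := sandwich_rotG_apply_of_rotI hK d x₁ x₂ 0 0
  have h1 := sandwich_rotG_apply_of_rotI hK d x₁ x₂ 1 0
  rw [rot_apply_00] at h0
  rw [rot_apply_10] at h1
  unfold cplxK
  exact Complex.ext h0 h1

end Cplx

/-! ## §4 THE WALK TERMS `C_ω` OF (2.42) FOR `C = (H|_Λ)^{−1}`: termwise covariance (any `H`, any walk, no (5.6)) and complex form -/

section WalkTerms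

variable {Λ : Finset (Balaban1983to89.Site P j)} {H : Matrix (Balaban1983to89.Site P j) (Balaban1983to89.Site P j) ℂ} {M : ℕ}

/-- **TERMWISE COVARIANCE OF THE WALK TERMS (2.42) on the torus**: for EVERY operator `H`, every `Λ ⊆ T^{(k)}` (wrapping or not), every cube
size `M`, every walk `ω` and every family of unit phases `d` on `Λ`, the walk term of the charted conjugate `(D H Dᴴ)|_Λ` is the gauge conjugate
of the walk term of `H|_Λ`: `C_ω[(DHDᴴ)|_Λ] = 𝒢_d C_ω[H|_Λ] 𝒢_dᵀ` — p13's `gconj_latticeCw` BY NAME on the key identity of §2 (no (5.6), no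
convergence needed: an identity of finite products). [cite: BalabanImbrieJaffe1988, p.265 (gauge covariance of the random walk operators), (2.42) p.264] -/
theorem latticeCw_reOp_sandwich {d : Balaban1983to89.Site P j → ℂ} (hd : ∀ x ∈ Λ, ‖d x‖ = 1) (ω : Walk ↥(labels M (chartSet Λ))) :
    latticeCw M (chartSet Λ) 2 (reOp Λ (diagonal d * H * (diagonal d)ᴴ)) ω = gconj (rotG Λ d) (latticeCw M (chartSet Λ) 2 (reOp Λ H) ω) := by
  rw [reOp_diagonal_sandwich, ← gconj_latticeCw (isGauge_rotG hd)]

/-- kernel form: `C_ω[(DHDᴴ)|_Λ](p, q) = (𝒢_d C_ω[H|_Λ] 𝒢_dᵀ)(p, q)` = p13's `sandwich`. [cite: BalabanImbrieJaffe1988, p.265 (gauge covariance of the random walk operators)] -/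
theorem latticeCw_reOp_sandwich_apply {d : Balaban1983to89.Site P j → ℂ} (hd : ∀ x ∈ Λ, ‖d x‖ = 1) (ω : Walk ↥(labels M (chartSet Λ)))
    (p q : B4.Idx (chartSet Λ) 2) :
    latticeCw M (chartSet Λ) 2 (reOp Λ (diagonal d * H * (diagonal d)ᴴ)) ω p q = sandwich (rotG Λ d) (latticeCw M (chartSet Λ) 2 (reOp Λ H) ω) p q := by
  rw [latticeCw_reOp_sandwich hd, gconj_apply]

/-- **the walk terms of a charted torus operator are `J`-invariant** (complex-linear): `𝒥 C_ω[H|_Λ] 𝒥ᵀ = C_ω[H|_Λ]` for the constant block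
`J = rot i`. [cite: BalabanImbrieJaffe1988, (2.42) p.264] -/
theorem sandwich_rotI_latticeCw_reOp (ω : Walk ↥(labels M (chartSet Λ))) (p q : B4.Idx (chartSet Λ) 2) :
    sandwich (rotG Λ fun _ => Complex.I) (latticeCw M (chartSet Λ) 2 (reOp Λ H) ω) p q = latticeCw M (chartSet Λ) 2 (reOp Λ H) ω p q := by
  rw [← gconj_apply, gconj_latticeCw isGauge_rotI, gconj_rotI_reOp]

/-- **The complex walk term `C^ℂ_ω(x₁, x₂)` of (2.42) for `C = (H|_Λ)^{−1}`** — the summand of gen 23's `hasSum_walkTerms_inv`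
(`C(x₁,x₂) = Σ_ω C^ℂ_ω(x₁,x₂)`): the complex number carried by the `2 × 2` block of p13's real walk term at `(x₁, x₂)`.
[cite: BalabanImbrieJaffe1988, (2.42) p.264] -/
def walkC (Λ : Finset (Balaban1983to89.Site P j)) (H : Matrix (Balaban1983to89.Site P j) (Balaban1983to89.Site P j) ℂ) (M : ℕ)
    (ω : Walk ↥(labels M (chartSet Λ))) (x₁ x₂ : ↥Λ) : ℂ :=
  cplxK Λ (latticeCw M (chartSet Λ) 2 (reOp Λ H) ω) x₁ x₂

/-- **the real walk term IS the realification pattern of the complex one**: `C_ω[H|_Λ]((x₁,a),(x₂,b)) = rot (C^ℂ_ω(x₁,x₂)) a b` — gen 23's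
«first column» reading of (2.42) loses nothing. [cite: BalabanImbrieJaffe1988, (2.42) p.264] -/
theorem latticeCw_reOp_apply_eq_rot (ω : Walk ↥(labels M (chartSet Λ))) (x₁ x₂ : ↥Λ) (a b : Fin 2) :
    latticeCw M (chartSet Λ) 2 (reOp Λ H) ω (idxEquiv Λ (x₁, a)) (idxEquiv Λ (x₂, b)) = rot (walkC Λ H M ω x₁ x₂) a b :=
  apply_eq_rot_cplxK_of_rotI (sandwich_rotI_latticeCw_reOp ω) x₁ x₂ a b

/-- **(2.42) in complex form, restated with `walkC`** (gen 23's `hasSum_walkTerms_inv` verbatim): under [6] (5.6) for the charted operator and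
p13's cube conditions, `C(x₁, x₂) = Σ_ω C^ℂ_ω(x₁, x₂)` unconditionally in `ℂ`. [cite: BalabanImbrieJaffe1988, (2.42) p.264] -/
theorem hasSum_walkC {γ₀ c₀ δ₀ : ℝ} (hγ : 0 < γ₀) (hc : 0 ≤ c₀) (hδ : 0 < δ₀) (hA : B4.Hyp56 (chartSet Λ) (reOp Λ H) γ₀ c₀ δ₀)
    (hU : IsUnit (compress Λ H)) (hM : 5 ≤ M) (hMR : kR P.d 2 γ₀ c₀ δ₀ < M) (hMθ : thetaConst P.d 2 γ₀ c₀ δ₀ < M) (x₁ x₂ : ↥Λ) :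
    HasSum (fun ω : Walk ↥(labels M (chartSet Λ)) => walkC Λ H M ω x₁ x₂) ((compress Λ H)⁻¹ x₁ x₂) :=
  hasSum_walkTerms_inv hγ hc hδ hA hU hM hMR hMθ x₁ x₂

/-- **THE PRINTED SENTENCE FOR THE WALK TERMS, COMPLEX FORM**: `C^ℂ_ω[(DHDᴴ)|_Λ](x₁, x₂) = d(x₁) · C^ℂ_ω[H|_Λ](x₁, x₂) · conj d(x₂)` —
*"by the difference of the gauge transformation between the points of evaluation of the kernel"* — every `H`, `Λ`, `M`, `ω`, unit phases `d`.
[cite: BalabanImbrieJaffe1988, p.265 (gauge covariance of the random walk operators)] -/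
theorem walkC_sandwich {d : Balaban1983to89.Site P j → ℂ} (hd : ∀ x ∈ Λ, ‖d x‖ = 1) (ω : Walk ↥(labels M (chartSet Λ))) (x₁ x₂ : ↥Λ) :
    walkC Λ (diagonal d * H * (diagonal d)ᴴ) M ω x₁ x₂ = d x₁.1 * walkC Λ H M ω x₁ x₂ * conj (d x₂.1) := by
  have hfun : (fun p q => latticeCw M (chartSet Λ) 2 (reOp Λ (diagonal d * H * (diagonal d)ᴴ)) ω p q) =
      sandwich (rotG Λ d) (latticeCw M (chartSet Λ) 2 (reOp Λ H) ω) :=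
    funext fun p => funext fun q => latticeCw_reOp_sandwich_apply hd ω p q
  unfold walkC
  rw [show cplxK Λ (latticeCw M (chartSet Λ) 2 (reOp Λ (diagonal d * H * (diagonal d)ᴴ)) ω) =
      cplxK Λ (sandwich (rotG Λ d) (latticeCw M (chartSet Λ) 2 (reOp Λ H) ω)) from congrArg (fun K => cplxK Λ K) hfun]
  exact cplxK_sandwich_rotG_of_rotI (sandwich_rotI_latticeCw_reOp ω) d x₁ x₂

end WalkTerms

/-! ## §5 THE RESUMMED PIECES `C_{Λ,loc}` (2.43), `C_{Λ,X}` (2.44) AND THE FULL COVARIANCE `C = (H|_Λ)^{−1}` -/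

section Resummed

variable {Λ : Finset (Balaban1983to89.Site P j)} {H : Matrix (Balaban1983to89.Site P j) (Balaban1983to89.Site P j) ℂ} {M : ℕ} {γ₀ c₀ δ₀ : ℝ}

/-- **The local part `C_{Λ,loc}` (2.43) of `C = (H|_Λ)^{−1}` as a real kernel on the charted `Λ × {Re, Im}`** — p13's `cLoc` of the walk
terms of `reOp Λ H`, radius `ρ` label units (gen 23's object in `eq245_realify_inv`/`abs_cLoc_le_walk`).
[cite: BalabanImbrieJaffe1988, (2.43) p.264] -/
def locK (Λ : Finset (Balaban1983to89.Site P j)) (H : Matrix (Balaban1983to89.Site P j) (Balaban1983to89.Site P j) ℂ) (M : ℕ) (ρ : ℝ) :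
    B4.Idx (chartSet Λ) 2 → B4.Idx (chartSet Λ) 2 → ℝ :=
  cLoc (ldist (N := 2) M) ρ (fun ω y₁ y₂ => latticeCw M (chartSet Λ) 2 (reOp Λ H) ω y₁ y₂)

/-- **The `X`-part `C_{Λ,X}` (2.44) of `C = (H|_Λ)^{−1}` as a real kernel** — p13's `cX` of the walk terms of `reOp Λ H` (`r(e_k)`-cubes of `s`
labels, touching adjacency, reading R1; gen 23's object in `eq245_realify_inv`/`abs_cX_le_walk`). [cite: BalabanImbrieJaffe1988, (2.44) p.264] -/
def regK (Λ : Finset (Balaban1983to89.Site P j)) (H : Matrix (Balaban1983to89.Site P j) (Balaban1983to89.Site P j) ℂ) (M s : ℕ) (ρ : ℝ)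
    (X : Finset (Cubes M s (chartSet Λ))) : B4.Idx (chartSet Λ) 2 → B4.Idx (chartSet Λ) 2 → ℝ :=
  cX (ldist (N := 2) M) ρ (cubeOf M s) touch (fun ω y₁ y₂ => latticeCw M (chartSet Λ) 2 (reOp Λ H) ω y₁ y₂) X

/-- **`C^ℂ_{Λ,loc}(x₁, x₂)`**: the local part (2.43) read as a complex kernel on `Λ`. [cite: BalabanImbrieJaffe1988, (2.43) p.264] -/
def locC (Λ : Finset (Balaban1983to89.Site P j)) (H : Matrix (Balaban1983to89.Site P j) (Balaban1983to89.Site P j) ℂ) (M : ℕ) (ρ : ℝ)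
    (x₁ x₂ : ↥Λ) : ℂ :=
  cplxK Λ (locK Λ H M ρ) x₁ x₂

/-- **`C^ℂ_{Λ,X}(x₁, x₂)`**: the `X`-part (2.44) read as a complex kernel on `Λ`. [cite: BalabanImbrieJaffe1988, (2.44) p.264] -/
def regC (Λ : Finset (Balaban1983to89.Site P j)) (H : Matrix (Balaban1983to89.Site P j) (Balaban1983to89.Site P j) ℂ) (M s : ℕ) (ρ : ℝ)
    (X : Finset (Cubes M s (chartSet Λ))) (x₁ x₂ : ↥Λ) : ℂ :=
  cplxK Λ (regK Λ H M s ρ X) x₁ x₂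

/-- **THE LOCAL PART (2.43) IS COVARIANT on the torus**: under [6] (5.6) for the charted `H|_Λ` and p13's cube conditions (absolute convergence of
the expansion), `C_{Λ,loc}[(DHDᴴ)|_Λ](p, q) = (𝒢_d C_{Λ,loc}[H|_Λ] 𝒢_dᵀ)(p, q)` for every radius `ρ` — p13's `cLoc_gauge` BY NAME on §2.
[cite: BalabanImbrieJaffe1988, p.265 (gauge covariance of the random walk operators), (2.43) p.264] -/
theorem locK_sandwich (hγ : 0 < γ₀) (hc : 0 ≤ c₀) (hδ : 0 < δ₀) (hA : B4.Hyp56 (chartSet Λ) (reOp Λ H) γ₀ c₀ δ₀) (hM : 5 ≤ M)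
    (hMR : kR P.d 2 γ₀ c₀ δ₀ < M) (hMθ : thetaConst P.d 2 γ₀ c₀ δ₀ < M) {d : Balaban1983to89.Site P j → ℂ} (hd : ∀ x ∈ Λ, ‖d x‖ = 1) (ρ : ℝ)
    (p q : B4.Idx (chartSet Λ) 2) :
    locK Λ (diagonal d * H * (diagonal d)ᴴ) M ρ p q = sandwich (rotG Λ d) (locK Λ H M ρ) p q := by
  unfold locK
  rw [reOp_diagonal_sandwich]
  exact cLoc_gauge hγ hc hδ hA hM hMR hMθ (isGauge_rotG hd) ρ p q

/-- **EVERY `X`-PART (2.44) IS COVARIANT on the torus**: under the same hypotheses, `C_{Λ,X}[(DHDᴴ)|_Λ](p, q) = (𝒢_d C_{Λ,X}[H|_Λ] 𝒢_dᵀ)(p, q)`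
for every cube region `X` (any `s`, `ρ`) — p13's `cX_gauge` BY NAME. [cite: BalabanImbrieJaffe1988, p.265 (gauge covariance of the random walk operators), (2.44) p.264] -/
theorem regK_sandwich (hγ : 0 < γ₀) (hc : 0 ≤ c₀) (hδ : 0 < δ₀) (hA : B4.Hyp56 (chartSet Λ) (reOp Λ H) γ₀ c₀ δ₀) (hM : 5 ≤ M)
    (hMR : kR P.d 2 γ₀ c₀ δ₀ < M) (hMθ : thetaConst P.d 2 γ₀ c₀ δ₀ < M) {d : Balaban1983to89.Site P j → ℂ} (hd : ∀ x ∈ Λ, ‖d x‖ = 1)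
    {s : ℕ} (ρ : ℝ) (X : Finset (Cubes M s (chartSet Λ))) (p q : B4.Idx (chartSet Λ) 2) :
    regK Λ (diagonal d * H * (diagonal d)ᴴ) M s ρ X p q = sandwich (rotG Λ d) (regK Λ H M s ρ X) p q := by
  unfold regK
  rw [reOp_diagonal_sandwich]
  exact cX_gauge hγ hc hδ hA hM hMR hMθ (isGauge_rotG hd) ρ X p q

/-- **the local part is `J`-invariant** (its blocks are complex numbers): `𝒥 C_{Λ,loc}[H|_Λ] 𝒥ᵀ = C_{Λ,loc}[H|_Λ]` (under (5.6)).
[cite: BalabanImbrieJaffe1988, (2.43) p.264] -/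
theorem sandwich_rotI_locK (hγ : 0 < γ₀) (hc : 0 ≤ c₀) (hδ : 0 < δ₀) (hA : B4.Hyp56 (chartSet Λ) (reOp Λ H) γ₀ c₀ δ₀) (hM : 5 ≤ M)
    (hMR : kR P.d 2 γ₀ c₀ δ₀ < M) (hMθ : thetaConst P.d 2 γ₀ c₀ δ₀ < M) (ρ : ℝ) (p q : B4.Idx (chartSet Λ) 2) :
    sandwich (rotG Λ fun _ => Complex.I) (locK Λ H M ρ) p q = locK Λ H M ρ p q := by
  have h := cLoc_gauge hγ hc hδ hA hM hMR hMθ (isGauge_rotI (Λ := Λ)) ρ p q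
  rw [gconj_rotI_reOp] at h
  exact h.symm

/-- **every `X`-part is `J`-invariant** (under (5.6)). [cite: BalabanImbrieJaffe1988, (2.44) p.264] -/
theorem sandwich_rotI_regK (hγ : 0 < γ₀) (hc : 0 ≤ c₀) (hδ : 0 < δ₀) (hA : B4.Hyp56 (chartSet Λ) (reOp Λ H) γ₀ c₀ δ₀) (hM : 5 ≤ M)
    (hMR : kR P.d 2 γ₀ c₀ δ₀ < M) (hMθ : thetaConst P.d 2 γ₀ c₀ δ₀ < M) {s : ℕ} (ρ : ℝ) (X : Finset (Cubes M s (chartSet Λ)))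
    (p q : B4.Idx (chartSet Λ) 2) :
    sandwich (rotG Λ fun _ => Complex.I) (regK Λ H M s ρ X) p q = regK Λ H M s ρ X p q := by
  have h := cX_gauge hγ hc hδ hA hM hMR hMθ (isGauge_rotI (Λ := Λ)) ρ X p q
  rw [gconj_rotI_reOp] at h
  exact h.symm

/-- **the real local part IS the realification pattern of `C^ℂ_{Λ,loc}`**: `C_{Λ,loc}((x₁,a),(x₂,b)) = rot (C^ℂ_{Λ,loc}(x₁,x₂)) a b` (under (5.6)).
[cite: BalabanImbrieJaffe1988, (2.43) p.264] -/
theorem locK_apply_eq_rot (hγ : 0 < γ₀) (hc : 0 ≤ c₀) (hδ : 0 < δ₀) (hA : B4.Hyp56 (chartSet Λ) (reOp Λ H) γ₀ c₀ δ₀) (hM : 5 ≤ M)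
    (hMR : kR P.d 2 γ₀ c₀ δ₀ < M) (hMθ : thetaConst P.d 2 γ₀ c₀ δ₀ < M) (ρ : ℝ) (x₁ x₂ : ↥Λ) (a b : Fin 2) :
    locK Λ H M ρ (idxEquiv Λ (x₁, a)) (idxEquiv Λ (x₂, b)) = rot (locC Λ H M ρ x₁ x₂) a b :=
  apply_eq_rot_cplxK_of_rotI (sandwich_rotI_locK hγ hc hδ hA hM hMR hMθ ρ) x₁ x₂ a b

/-- **the real `X`-part IS the realification pattern of `C^ℂ_{Λ,X}`** (under (5.6)). [cite: BalabanImbrieJaffe1988, (2.44) p.264] -/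
theorem regK_apply_eq_rot (hγ : 0 < γ₀) (hc : 0 ≤ c₀) (hδ : 0 < δ₀) (hA : B4.Hyp56 (chartSet Λ) (reOp Λ H) γ₀ c₀ δ₀) (hM : 5 ≤ M)
    (hMR : kR P.d 2 γ₀ c₀ δ₀ < M) (hMθ : thetaConst P.d 2 γ₀ c₀ δ₀ < M) {s : ℕ} (ρ : ℝ) (X : Finset (Cubes M s (chartSet Λ)))
    (x₁ x₂ : ↥Λ) (a b : Fin 2) :
    regK Λ H M s ρ X (idxEquiv Λ (x₁, a)) (idxEquiv Λ (x₂, b)) = rot (regC Λ H M s ρ X x₁ x₂) a b :=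
  apply_eq_rot_cplxK_of_rotI (sandwich_rotI_regK hγ hc hδ hA hM hMR hMθ ρ X) x₁ x₂ a b

/-- **THE PRINTED SENTENCE FOR THE LOCAL PART (2.43), COMPLEX FORM**: `C^ℂ_{Λ,loc}[(DHDᴴ)|_Λ](x₁,x₂) = d(x₁) · C^ℂ_{Λ,loc}[H|_Λ](x₁,x₂) · conj d(x₂)`
(under [6] (5.6) for the charted `H|_Λ` and p13's cube conditions). [cite: BalabanImbrieJaffe1988, p.265 (gauge covariance of the random walk operators), (2.43) p.264] -/
theorem locC_sandwich (hγ : 0 < γ₀) (hc : 0 ≤ c₀) (hδ : 0 < δ₀) (hA : B4.Hyp56 (chartSet Λ) (reOp Λ H) γ₀ c₀ δ₀) (hM : 5 ≤ M)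
    (hMR : kR P.d 2 γ₀ c₀ δ₀ < M) (hMθ : thetaConst P.d 2 γ₀ c₀ δ₀ < M) {d : Balaban1983to89.Site P j → ℂ} (hd : ∀ x ∈ Λ, ‖d x‖ = 1) (ρ : ℝ)
    (x₁ x₂ : ↥Λ) :
    locC Λ (diagonal d * H * (diagonal d)ᴴ) M ρ x₁ x₂ = d x₁.1 * locC Λ H M ρ x₁ x₂ * conj (d x₂.1) := by
  have hfun : locK Λ (diagonal d * H * (diagonal d)ᴴ) M ρ = sandwich (rotG Λ d) (locK Λ H M ρ) :=
    funext fun p => funext fun q => locK_sandwich hγ hc hδ hA hM hMR hMθ hd ρ p q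
  unfold locC
  rw [hfun]
  exact cplxK_sandwich_rotG_of_rotI (sandwich_rotI_locK hγ hc hδ hA hM hMR hMθ ρ) d x₁ x₂

/-- **THE PRINTED SENTENCE FOR THE `X`-PARTS (2.44), COMPLEX FORM**: `C^ℂ_{Λ,X}[(DHDᴴ)|_Λ](x₁,x₂) = d(x₁) · C^ℂ_{Λ,X}[H|_Λ](x₁,x₂) · conj d(x₂)`
for every cube region `X` (under (5.6) + p13's cube conditions). [cite: BalabanImbrieJaffe1988, p.265 (gauge covariance of the random walk operators), (2.44) p.264] -/
theorem regC_sandwich (hγ : 0 < γ₀) (hc : 0 ≤ c₀) (hδ : 0 < δ₀) (hA : B4.Hyp56 (chartSet Λ) (reOp Λ H) γ₀ c₀ δ₀) (hM : 5 ≤ M)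
    (hMR : kR P.d 2 γ₀ c₀ δ₀ < M) (hMθ : thetaConst P.d 2 γ₀ c₀ δ₀ < M) {d : Balaban1983to89.Site P j → ℂ} (hd : ∀ x ∈ Λ, ‖d x‖ = 1)
    {s : ℕ} (ρ : ℝ) (X : Finset (Cubes M s (chartSet Λ))) (x₁ x₂ : ↥Λ) :
    regC Λ (diagonal d * H * (diagonal d)ᴴ) M s ρ X x₁ x₂ = d x₁.1 * regC Λ H M s ρ X x₁ x₂ * conj (d x₂.1) := by
  have hfun : regK Λ (diagonal d * H * (diagonal d)ᴴ) M s ρ X = sandwich (rotG Λ d) (regK Λ H M s ρ X) :=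
    funext fun p => funext fun q => regK_sandwich hγ hc hδ hA hM hMR hMθ hd ρ X p q
  unfold regC
  rw [hfun]
  exact cplxK_sandwich_rotG_of_rotI (sandwich_rotI_regK hγ hc hδ hA hM hMR hMθ ρ X) d x₁ x₂

/-- **(2.45) IN COMPLEX FORM on the torus**: `C(x₁, x₂) = C^ℂ_{Λ,loc}(x₁, x₂) + Σ_X C^ℂ_{Λ,X}(x₁, x₂)` for `C = (H|_Λ)^{−1}`, the finite sum over
all cube sets `X` (gen 23's `eq245_realify_inv` at the `(Re,Re)` and `(Im,Re)` entries; under (5.6) + p13's cube conditions, `H|_Λ` invertible).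
[cite: BalabanImbrieJaffe1988, (2.45) p.264] -/
theorem eq245_cplx (hγ : 0 < γ₀) (hc : 0 ≤ c₀) (hδ : 0 < δ₀) (hA : B4.Hyp56 (chartSet Λ) (reOp Λ H) γ₀ c₀ δ₀) (hU : IsUnit (compress Λ H))
    (hM : 5 ≤ M) (hMR : kR P.d 2 γ₀ c₀ δ₀ < M) (hMθ : thetaConst P.d 2 γ₀ c₀ δ₀ < M) (ρ : ℝ) (s : ℕ) (x₁ x₂ : ↥Λ) :
    (compress Λ H)⁻¹ x₁ x₂ = locC Λ H M ρ x₁ x₂ + ∑ X : Finset (Cubes M s (chartSet Λ)), regC Λ H M s ρ X x₁ x₂ := by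
  have h0 := eq245_realify_inv hγ hc hδ hA hU hM hMR hMθ ρ s (x₁, 0) (x₂, 0)
  have h1 := eq245_realify_inv hγ hc hδ hA hU hM hMR hMθ ρ s (x₁, 1) (x₂, 0)
  dsimp only at h0 h1
  rw [realify_apply_fst] at h0
  rw [realify_apply_snd] at h1
  apply Complex.ext
  · rw [Complex.add_re, Complex.re_sum]
    exact h0
  · rw [Complex.add_im, Complex.im_sum]
    exact h1

/-- kernel: a diagonal of unit phases restricted to `Λ` is unitary (both orders). [folklore] (bookkeeping for Bałaban–Imbrie–Jaffe, CMP **114**, p. 265) -/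
private theorem diagonal_unit_mul {d : Balaban1983to89.Site P j → ℂ} (hd : ∀ x ∈ Λ, ‖d x‖ = 1) :
    (diagonal fun x : ↥Λ => d x.1)ᴴ * diagonal (fun x : ↥Λ => d x.1) = 1 ∧
      diagonal (fun x : ↥Λ => d x.1) * (diagonal fun x : ↥Λ => d x.1)ᴴ = 1 := by
  have hmul : ∀ x : ↥Λ, conj (d x.1) * d x.1 = 1 := fun x => by
    rw [← Complex.normSq_eq_conj_mul_self, Complex.normSq_eq_norm_sq, hd _ x.2]
    norm_num
  refine ⟨?_, ?_⟩
  · rw [diagonal_conjTranspose, diagonal_mul_diagonal, ← diagonal_one]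
    congr 1
    funext x
    rw [Pi.star_apply, Complex.star_def, hmul]
  · rw [diagonal_conjTranspose, diagonal_mul_diagonal, ← diagonal_one]
    congr 1
    funext x
    rw [Pi.star_apply, Complex.star_def, mul_comm, hmul]

/-- **THE FULL COVARIANCE IS COVARIANT** (no convergence hypothesis): `[(DHDᴴ)|_Λ]^{−1} = D_Λ [H|_Λ]^{−1} D_Λᴴ` for unit phases `d`
(the printed `C^{(k)}_Λ(u)` itself; p13's `compress_inv_gconj`/`inv_gauge_apply` in complex form). [cite: BalabanImbrieJaffe1988, p.265 (gauge covariance of the random walk operators), (2.40) p.264] -/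
theorem inv_compress_diagonal_sandwich {d : Balaban1983to89.Site P j → ℂ} (hd : ∀ x ∈ Λ, ‖d x‖ = 1) :
    (compress Λ (diagonal d * H * (diagonal d)ᴴ))⁻¹ =
      diagonal (fun x : ↥Λ => d x.1) * (compress Λ H)⁻¹ * (diagonal fun x : ↥Λ => d x.1)ᴴ := by
  obtain ⟨h1, h2⟩ := diagonal_unit_mul hd
  rw [compress_diagonal_sandwich, Matrix.mul_inv_rev, Matrix.mul_inv_rev, Matrix.inv_eq_left_inv h2, Matrix.inv_eq_left_inv h1,
    Matrix.mul_assoc]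

/-- **kernel form — the printed sentence for `C^{(k)}_Λ` itself**: `[(DHDᴴ)|_Λ]^{−1}(x₁,x₂) = d(x₁) · [H|_Λ]^{−1}(x₁,x₂) · conj d(x₂)`.
[cite: BalabanImbrieJaffe1988, p.265 (gauge covariance of the random walk operators), (2.40) p.264] -/
theorem inv_compress_diagonal_sandwich_apply {d : Balaban1983to89.Site P j → ℂ} (hd : ∀ x ∈ Λ, ‖d x‖ = 1) (x₁ x₂ : ↥Λ) :
    (compress Λ (diagonal d * H * (diagonal d)ᴴ))⁻¹ x₁ x₂ = d x₁.1 * (compress Λ H)⁻¹ x₁ x₂ * conj (d x₂.1) := by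
  rw [inv_compress_diagonal_sandwich hd, diagonal_sandwich_apply]

/-- **[6] (5.6) TRANSPORTS ALONG THE GAUGE ORBIT** (p13's `hyp56_gconj` BY NAME, `N = 2`): if the charted `H|_Λ` satisfies `Hyp56 · γ₀ c₀ δ₀`,
the charted `(DHDᴴ)|_Λ` satisfies `Hyp56 · γ₀ (4c₀) δ₀` — so the expansion (2.42)/(2.45) and gen 23's members apply at the conjugate too.
[cite: Balaban1983RegularityDecay, (5.6) p.594] [cite: BalabanImbrieJaffe1988, p.265 (gauge covariance of the random walk operators)] -/
theorem hyp56_reOp_diagonal_sandwich {d : Balaban1983to89.Site P j → ℂ} (hd : ∀ x ∈ Λ, ‖d x‖ = 1)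
    (hA : B4.Hyp56 (chartSet Λ) (reOp Λ H) γ₀ c₀ δ₀) :
    B4.Hyp56 (chartSet Λ) (reOp Λ (diagonal d * H * (diagonal d)ᴴ)) γ₀ (4 * c₀) δ₀ := by
  rw [reOp_diagonal_sandwich]
  have h := hyp56_gconj (isGauge_rotG hd) hA
  norm_num at h
  exact h

end Resummed

/-! ## §6 THE MODEL: `H(u) = Δ_{k,loc}(u) + κP(ū_k)` — p13's displayed hypothesis `A′ = 𝒢A𝒢ᵀ` DISCHARGED, and the printed sentence for the
model's `C^{(k)}_{Λ,ω}(u)`, `C^{(k)}_{Λ,loc}(u)`, `C^{(k)}_{Λ,X}(u)`, `C^{(k)}_Λ(u)` -/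

section Model

variable {k : ℕ} {ι : Type*} [Fintype ι] {a c : ℝ}

/-- kernel: the phases of the gauge transformation at the points of evaluation are unit complex numbers.
[cite: BalabanImbrieJaffe1985, (2.8) p.303] -/
theorem norm_phase (h : GaugeTransf P j U1) (Λ : Finset (Balaban1983to89.Site P (j + k))) :
    ∀ x ∈ Λ, ‖(fun y : Balaban1983to89.Site P (j + k) => toC (h (cornerIter k y))) x‖ = 1 :=
  fun _ _ => norm_toC _

/-- **p13's DISPLAYED HYPOTHESIS `A′ = 𝒢A𝒢ᵀ` DISCHARGED FOR THE MODEL** (`BIJ88WalkGaugeCovariance` HONEST SCOPE: *"that the print's operator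
… of (2.40) at the transformed background u^λ IS the conjugate 𝒢_λ(·)𝒢_λᵀ of the one at u is the model's input …, displayed here as the
hypothesis `A′ = 𝒢A𝒢ᵀ`, not proved"*): for the precision `H(u) = Δ_{k,loc}(u) + κP(ū_k)` of (2.40)/(4.9) WITH BODY (p34's `prec49 a c U k cube λ
ζ″ κ` = gen 15/18's `op240 (deltaLocT a c U k cube λ ζ″) κ (ū_k)`, `ū_k = barUc k U` = p11's `lineIter U k` by p30's
`BIJ88Eq44CornerCentre.barUc_eq_lineIter`), EVERY region `Λ ⊆ T₁^{(k)}` (wrapping the torus or not), every `U(1)` background `u`, every gauge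
transformation `h` of `T_η`: the charted real operator at `u^h` IS p13's gauge conjugate of the one at `u` by the phases `h` at the corner
points of the blocks — p34's (4.16) identity `prec49_gaugeAct` (from gen 15's `deltaLocT_gaugeAct`, p11's (2.8)) through the key identity of §2.
Standing data: cube family of `k`-block unions, `a > 0`, `c ≠ 0`, `j + k + 1 ≤ m + K`.
[cite: BalabanImbrieJaffe1988, p.265 (gauge covariance of the random walk operators), (2.40) p.264, (4.16) p.276] -/
theorem reOp_prec49_gaugeAct (hk : j + k + 1 ≤ P.m + P.K) (hc : c ≠ 0) (ha : 0 < a) (h : GaugeTransf P j U1) (U : GaugeField P j U1)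
    {cube : ι → Finset (Balaban1983to89.Site P j)} (hcube : ∀ α, IsBlockUnion k (cube α))
    (lam : ι → Balaban1983to89.Site P j → Balaban1983to89.Site P j → ℝ) (ζ'' : Balaban1983to89.Site P j → Balaban1983to89.Site P j → ℝ) (κ : ℝ)
    (Λ : Finset (Balaban1983to89.Site P (j + k))) :
    reOp Λ (prec49 a c (gaugeAct h U) k cube lam ζ'' κ) =
      gconj (rotG Λ fun y => toC (h (cornerIter k y))) (reOp Λ (prec49 a c U k cube lam ζ'' κ)) := by
  rw [prec49_gaugeAct hk hc ha h U hcube]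
  exact reOp_diagonal_sandwich _ _

/-- **THE MODEL'S WALK TERMS `C^{(k)}_{Λ,ω}(u)` OF (2.42) TRANSFORM BY CONJUGATION** — termwise, EVERY walk, every `Λ`, every cube size `M`, no
(5.6): `C_ω[u^h] = 𝒢_h C_ω[u] 𝒢_hᵀ`. [cite: BalabanImbrieJaffe1988, p.265 (gauge covariance of the random walk operators), (2.42) p.264] -/
theorem latticeCw_prec49_gaugeAct (hk : j + k + 1 ≤ P.m + P.K) (hc : c ≠ 0) (ha : 0 < a) (h : GaugeTransf P j U1) (U : GaugeField P j U1)
    {cube : ι → Finset (Balaban1983to89.Site P j)} (hcube : ∀ α, IsBlockUnion k (cube α))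
    (lam : ι → Balaban1983to89.Site P j → Balaban1983to89.Site P j → ℝ) (ζ'' : Balaban1983to89.Site P j → Balaban1983to89.Site P j → ℝ) (κ : ℝ)
    (Λ : Finset (Balaban1983to89.Site P (j + k))) {M : ℕ} (ω : Walk ↥(labels M (chartSet Λ))) :
    latticeCw M (chartSet Λ) 2 (reOp Λ (prec49 a c (gaugeAct h U) k cube lam ζ'' κ)) ω =
      gconj (rotG Λ fun y => toC (h (cornerIter k y))) (latticeCw M (chartSet Λ) 2 (reOp Λ (prec49 a c U k cube lam ζ'' κ)) ω) := by
  rw [prec49_gaugeAct hk hc ha h U hcube]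
  exact latticeCw_reOp_sandwich (norm_phase h Λ) ω

/-- **THE PRINTED SENTENCE FOR THE MODEL'S COMPLEX WALK TERMS**: `C^ℂ_ω[u^h](x₁, x₂) = h(x₁) · C^ℂ_ω[u](x₁, x₂) · conj h(x₂)` with `h(x)` the phase
of the gauge transformation at the point of evaluation `x ∈ T₁^{(k)}` (its corner point in `T_η`, [BalabanImbrieJaffe1985] (2.8)) — *"by the
difference of the gauge transformation between the points of evaluation of the kernel"*; every `Λ`, `M`, `ω`, no (5.6).
[cite: BalabanImbrieJaffe1988, p.265 (gauge covariance of the random walk operators), (2.42) p.264] -/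
theorem walkC_prec49_gaugeAct (hk : j + k + 1 ≤ P.m + P.K) (hc : c ≠ 0) (ha : 0 < a) (h : GaugeTransf P j U1) (U : GaugeField P j U1)
    {cube : ι → Finset (Balaban1983to89.Site P j)} (hcube : ∀ α, IsBlockUnion k (cube α))
    (lam : ι → Balaban1983to89.Site P j → Balaban1983to89.Site P j → ℝ) (ζ'' : Balaban1983to89.Site P j → Balaban1983to89.Site P j → ℝ) (κ : ℝ)
    (Λ : Finset (Balaban1983to89.Site P (j + k))) (M : ℕ) (ω : Walk ↥(labels M (chartSet Λ))) (x₁ x₂ : ↥Λ) :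
    walkC Λ (prec49 a c (gaugeAct h U) k cube lam ζ'' κ) M ω x₁ x₂ =
      toC (h (cornerIter k x₁.1)) * walkC Λ (prec49 a c U k cube lam ζ'' κ) M ω x₁ x₂ * conj (toC (h (cornerIter k x₂.1))) := by
  rw [prec49_gaugeAct hk hc ha h U hcube]
  exact walkC_sandwich (norm_phase h Λ) ω x₁ x₂

/-- the same with the printed **difference of the gauge transformation** `h(x₁)h(x₂)^{−1}` as ONE phase (abelian group: `conj h(x₂) = h(x₂)^{−1}`):
`C^ℂ_ω[u^h](x₁, x₂) = (h(x₁)h(x₂)^{−1}) · C^ℂ_ω[u](x₁, x₂)`. [cite: BalabanImbrieJaffe1988, p.265 (gauge covariance of the random walk operators)] -/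
theorem walkC_prec49_gaugeAct' (hk : j + k + 1 ≤ P.m + P.K) (hc : c ≠ 0) (ha : 0 < a) (h : GaugeTransf P j U1) (U : GaugeField P j U1)
    {cube : ι → Finset (Balaban1983to89.Site P j)} (hcube : ∀ α, IsBlockUnion k (cube α))
    (lam : ι → Balaban1983to89.Site P j → Balaban1983to89.Site P j → ℝ) (ζ'' : Balaban1983to89.Site P j → Balaban1983to89.Site P j → ℝ) (κ : ℝ)
    (Λ : Finset (Balaban1983to89.Site P (j + k))) (M : ℕ) (ω : Walk ↥(labels M (chartSet Λ))) (x₁ x₂ : ↥Λ) :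
    walkC Λ (prec49 a c (gaugeAct h U) k cube lam ζ'' κ) M ω x₁ x₂ =
      toC (h (cornerIter k x₁.1) * (h (cornerIter k x₂.1))⁻¹) * walkC Λ (prec49 a c U k cube lam ζ'' κ) M ω x₁ x₂ := by
  rw [walkC_prec49_gaugeAct hk hc ha h U hcube, BIJ88Sect3Statements.toC_mul, BIJ88Sect3Statements.toC_inv]
  have hconj : conj (toC (h (cornerIter k x₂.1))) = (toC (h (cornerIter k x₂.1)))⁻¹ := by
    rw [Complex.inv_def, Complex.normSq_eq_norm_sq, norm_toC, one_pow, inv_one, Complex.ofReal_one, mul_one]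
  rw [hconj]
  ring

/-- **THE MODEL'S LOCAL PART `C^{(k)}_{Λ,loc}(u)` (2.43) AND `X`-PARTS `C^{(k)}_{Λ,X}(u)` (2.44) TRANSFORM BY CONJUGATION** — under [6] (5.6) for the
charted `H(u)|_Λ` (INHABITED for this operator by gen 23's `hyp56_deltaLocT_smallPlaquette_torus_cwt` at a small-plaquette background with the
printed torus data, `…Cwt.hyp56_deltaLocT_gen` in general position, `BIJ88Eq242HiggsCovarianceActualBackground.hyp56_deltaLocT_actualBg` at the
actual background; all in the `lineIter` currency = `barUc` by p30's `barUc_eq_lineIter`) and p13's cube conditions: real (sandwich) forms.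
[cite: BalabanImbrieJaffe1988, p.265 (gauge covariance of the random walk operators), (2.43)–(2.44) p.264] -/
theorem locK_regK_prec49_gaugeAct (hk : j + k + 1 ≤ P.m + P.K) (hc : c ≠ 0) (ha : 0 < a) (h : GaugeTransf P j U1) (U : GaugeField P j U1)
    {cube : ι → Finset (Balaban1983to89.Site P j)} (hcube : ∀ α, IsBlockUnion k (cube α))
    (lam : ι → Balaban1983to89.Site P j → Balaban1983to89.Site P j → ℝ) (ζ'' : Balaban1983to89.Site P j → Balaban1983to89.Site P j → ℝ) (κ : ℝ)
    (Λ : Finset (Balaban1983to89.Site P (j + k))) {M : ℕ} {γ₀ c₀ δ₀ : ℝ} (hγ : 0 < γ₀) (hc₀ : 0 ≤ c₀) (hδ : 0 < δ₀)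
    (hA : B4.Hyp56 (chartSet Λ) (reOp Λ (prec49 a c U k cube lam ζ'' κ)) γ₀ c₀ δ₀) (hM : 5 ≤ M)
    (hMR : kR P.d 2 γ₀ c₀ δ₀ < M) (hMθ : thetaConst P.d 2 γ₀ c₀ δ₀ < M) (ρ : ℝ) {s : ℕ} (X : Finset (Cubes M s (chartSet Λ)))
    (p q : B4.Idx (chartSet Λ) 2) :
    locK Λ (prec49 a c (gaugeAct h U) k cube lam ζ'' κ) M ρ p q =
        sandwich (rotG Λ fun y => toC (h (cornerIter k y))) (locK Λ (prec49 a c U k cube lam ζ'' κ) M ρ) p q ∧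
      regK Λ (prec49 a c (gaugeAct h U) k cube lam ζ'' κ) M s ρ X p q =
        sandwich (rotG Λ fun y => toC (h (cornerIter k y))) (regK Λ (prec49 a c U k cube lam ζ'' κ) M s ρ X) p q := by
  rw [prec49_gaugeAct hk hc ha h U hcube]
  exact ⟨locK_sandwich hγ hc₀ hδ hA hM hMR hMθ (norm_phase h Λ) ρ p q, regK_sandwich hγ hc₀ hδ hA hM hMR hMθ (norm_phase h Λ) ρ X p q⟩

/-- **THE PRINTED SENTENCE FOR THE MODEL'S `C^ℂ_{Λ,loc}(u)` AND `C^ℂ_{Λ,X}(u)`, COMPLEX FORM**: under the same hypotheses,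
`C^ℂ_{Λ,loc}[u^h](x₁,x₂) = h(x₁) · C^ℂ_{Λ,loc}[u](x₁,x₂) · conj h(x₂)` and `C^ℂ_{Λ,X}[u^h](x₁,x₂) = h(x₁) · C^ℂ_{Λ,X}[u](x₁,x₂) · conj h(x₂)` for every
cube region `X`. [cite: BalabanImbrieJaffe1988, p.265 (gauge covariance of the random walk operators), (2.43)–(2.44) p.264] -/
theorem locC_regC_prec49_gaugeAct (hk : j + k + 1 ≤ P.m + P.K) (hc : c ≠ 0) (ha : 0 < a) (h : GaugeTransf P j U1) (U : GaugeField P j U1)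
    {cube : ι → Finset (Balaban1983to89.Site P j)} (hcube : ∀ α, IsBlockUnion k (cube α))
    (lam : ι → Balaban1983to89.Site P j → Balaban1983to89.Site P j → ℝ) (ζ'' : Balaban1983to89.Site P j → Balaban1983to89.Site P j → ℝ) (κ : ℝ)
    (Λ : Finset (Balaban1983to89.Site P (j + k))) {M : ℕ} {γ₀ c₀ δ₀ : ℝ} (hγ : 0 < γ₀) (hc₀ : 0 ≤ c₀) (hδ : 0 < δ₀)
    (hA : B4.Hyp56 (chartSet Λ) (reOp Λ (prec49 a c U k cube lam ζ'' κ)) γ₀ c₀ δ₀) (hM : 5 ≤ M)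
    (hMR : kR P.d 2 γ₀ c₀ δ₀ < M) (hMθ : thetaConst P.d 2 γ₀ c₀ δ₀ < M) (ρ : ℝ) {s : ℕ} (X : Finset (Cubes M s (chartSet Λ))) (x₁ x₂ : ↥Λ) :
    locC Λ (prec49 a c (gaugeAct h U) k cube lam ζ'' κ) M ρ x₁ x₂ =
        toC (h (cornerIter k x₁.1)) * locC Λ (prec49 a c U k cube lam ζ'' κ) M ρ x₁ x₂ * conj (toC (h (cornerIter k x₂.1))) ∧
      regC Λ (prec49 a c (gaugeAct h U) k cube lam ζ'' κ) M s ρ X x₁ x₂ =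
        toC (h (cornerIter k x₁.1)) * regC Λ (prec49 a c U k cube lam ζ'' κ) M s ρ X x₁ x₂ * conj (toC (h (cornerIter k x₂.1))) := by
  rw [prec49_gaugeAct hk hc ha h U hcube]
  exact ⟨locC_sandwich hγ hc₀ hδ hA hM hMR hMθ (norm_phase h Λ) ρ x₁ x₂, regC_sandwich hγ hc₀ hδ hA hM hMR hMθ (norm_phase h Λ) ρ X x₁ x₂⟩

/-- **THE PRINTED SENTENCE FOR THE MODEL'S COVARIANCE `C^{(k)}_Λ(u)` ITSELF** (no convergence hypothesis): `C^{(k)}_Λ(u^h; x₁, x₂) =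
h(x₁) · C^{(k)}_Λ(u; x₁, x₂) · conj h(x₂)`, every `Λ ⊆ T₁^{(k)}`. [cite: BalabanImbrieJaffe1988, p.265 (gauge covariance of the random walk operators), (2.40) p.264] -/
theorem inv_compress_prec49_gaugeAct_apply (hk : j + k + 1 ≤ P.m + P.K) (hc : c ≠ 0) (ha : 0 < a) (h : GaugeTransf P j U1)
    (U : GaugeField P j U1) {cube : ι → Finset (Balaban1983to89.Site P j)} (hcube : ∀ α, IsBlockUnion k (cube α))
    (lam : ι → Balaban1983to89.Site P j → Balaban1983to89.Site P j → ℝ) (ζ'' : Balaban1983to89.Site P j → Balaban1983to89.Site P j → ℝ) (κ : ℝ)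
    (Λ : Finset (Balaban1983to89.Site P (j + k))) (x₁ x₂ : ↥Λ) :
    (compress Λ (prec49 a c (gaugeAct h U) k cube lam ζ'' κ))⁻¹ x₁ x₂ =
      toC (h (cornerIter k x₁.1)) * (compress Λ (prec49 a c U k cube lam ζ'' κ))⁻¹ x₁ x₂ * conj (toC (h (cornerIter k x₂.1))) := by
  rw [prec49_gaugeAct hk hc ha h U hcube]
  exact inv_compress_diagonal_sandwich_apply (norm_phase h Λ) x₁ x₂

/-- **[6] (5.6) for the model's charted precision transports along the gauge orbit** (`c₀ ↦ 4c₀`): the random walk expansion and gen 23's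
(2.42)/(2.45)/(2.41)/(2.46)/(2.47) members apply at `u^h` whenever they apply at `u`. [cite: Balaban1983RegularityDecay, (5.6) p.594]
[cite: BalabanImbrieJaffe1988, p.265 (gauge covariance of the random walk operators)] -/
theorem hyp56_reOp_prec49_gaugeAct (hk : j + k + 1 ≤ P.m + P.K) (hc : c ≠ 0) (ha : 0 < a) (h : GaugeTransf P j U1) (U : GaugeField P j U1)
    {cube : ι → Finset (Balaban1983to89.Site P j)} (hcube : ∀ α, IsBlockUnion k (cube α))
    (lam : ι → Balaban1983to89.Site P j → Balaban1983to89.Site P j → ℝ) (ζ'' : Balaban1983to89.Site P j → Balaban1983to89.Site P j → ℝ) (κ : ℝ)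
    (Λ : Finset (Balaban1983to89.Site P (j + k))) {γ₀ c₀ δ₀ : ℝ} (hA : B4.Hyp56 (chartSet Λ) (reOp Λ (prec49 a c U k cube lam ζ'' κ)) γ₀ c₀ δ₀) :
    B4.Hyp56 (chartSet Λ) (reOp Λ (prec49 a c (gaugeAct h U) k cube lam ζ'' κ)) γ₀ (4 * c₀) δ₀ := by
  rw [prec49_gaugeAct hk hc ha h U hcube]
  exact hyp56_reOp_diagonal_sandwich (norm_phase h Λ) hA

/-- kernel: a unit-phase sandwich does not change the norm. [folklore] (bookkeeping for Bałaban–Imbrie–Jaffe, CMP **114**, p. 265) -/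
private theorem norm_phase_sandwich (g₁ g₂ : U1) (z : ℂ) : ‖toC g₁ * z * conj (toC g₂)‖ = ‖z‖ := by
  rw [norm_mul, norm_mul, Complex.norm_conj, norm_toC, norm_toC, one_mul, mul_one]

/-- **COROLLARY — THE SIZES OF THE MODEL'S WALK PIECES ARE GAUGE INVARIANT**: `‖C^ℂ_ω[u^h](x₁,x₂)‖ = ‖C^ℂ_ω[u](x₁,x₂)‖` for every walk (so the
termwise inputs of (2.41)/(2.46)/(2.47) are statements about the gauge orbit), and `‖C^{(k)}_Λ(u^h; x₁,x₂)‖ = ‖C^{(k)}_Λ(u; x₁,x₂)‖`; no (5.6).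
[cite: BalabanImbrieJaffe1988, p.265 (gauge covariance of the random walk operators), (2.41) p.264] -/
theorem norm_walkC_prec49_gaugeAct (hk : j + k + 1 ≤ P.m + P.K) (hc : c ≠ 0) (ha : 0 < a) (h : GaugeTransf P j U1) (U : GaugeField P j U1)
    {cube : ι → Finset (Balaban1983to89.Site P j)} (hcube : ∀ α, IsBlockUnion k (cube α))
    (lam : ι → Balaban1983to89.Site P j → Balaban1983to89.Site P j → ℝ) (ζ'' : Balaban1983to89.Site P j → Balaban1983to89.Site P j → ℝ) (κ : ℝ)
    (Λ : Finset (Balaban1983to89.Site P (j + k))) (M : ℕ) (ω : Walk ↥(labels M (chartSet Λ))) (x₁ x₂ : ↥Λ) :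
    ‖walkC Λ (prec49 a c (gaugeAct h U) k cube lam ζ'' κ) M ω x₁ x₂‖ = ‖walkC Λ (prec49 a c U k cube lam ζ'' κ) M ω x₁ x₂‖ ∧
      ‖(compress Λ (prec49 a c (gaugeAct h U) k cube lam ζ'' κ))⁻¹ x₁ x₂‖ = ‖(compress Λ (prec49 a c U k cube lam ζ'' κ))⁻¹ x₁ x₂‖ := by
  rw [walkC_prec49_gaugeAct hk hc ha h U hcube, inv_compress_prec49_gaugeAct_apply hk hc ha h U hcube, norm_phase_sandwich,
    norm_phase_sandwich]
  exact ⟨rfl, rfl⟩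

/-- **COROLLARY — THE SIZES OF `C^ℂ_{Λ,loc}(u)` AND `C^ℂ_{Λ,X}(u)` ARE GAUGE INVARIANT** (under (5.6) for the charted `H(u)|_Λ` + p13's cube
conditions): the bounds (2.43) «bounded as in (2.41)», (2.46), (2.47) proved at `u` hold verbatim at `u^h`.
[cite: BalabanImbrieJaffe1988, p.265 (gauge covariance of the random walk operators), (2.46)–(2.47) p.264–265] -/
theorem norm_locC_regC_prec49_gaugeAct (hk : j + k + 1 ≤ P.m + P.K) (hc : c ≠ 0) (ha : 0 < a) (h : GaugeTransf P j U1) (U : GaugeField P j U1)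
    {cube : ι → Finset (Balaban1983to89.Site P j)} (hcube : ∀ α, IsBlockUnion k (cube α))
    (lam : ι → Balaban1983to89.Site P j → Balaban1983to89.Site P j → ℝ) (ζ'' : Balaban1983to89.Site P j → Balaban1983to89.Site P j → ℝ) (κ : ℝ)
    (Λ : Finset (Balaban1983to89.Site P (j + k))) {M : ℕ} {γ₀ c₀ δ₀ : ℝ} (hγ : 0 < γ₀) (hc₀ : 0 ≤ c₀) (hδ : 0 < δ₀)
    (hA : B4.Hyp56 (chartSet Λ) (reOp Λ (prec49 a c U k cube lam ζ'' κ)) γ₀ c₀ δ₀) (hM : 5 ≤ M)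
    (hMR : kR P.d 2 γ₀ c₀ δ₀ < M) (hMθ : thetaConst P.d 2 γ₀ c₀ δ₀ < M) (ρ : ℝ) {s : ℕ} (X : Finset (Cubes M s (chartSet Λ))) (x₁ x₂ : ↥Λ) :
    ‖locC Λ (prec49 a c (gaugeAct h U) k cube lam ζ'' κ) M ρ x₁ x₂‖ = ‖locC Λ (prec49 a c U k cube lam ζ'' κ) M ρ x₁ x₂‖ ∧
      ‖regC Λ (prec49 a c (gaugeAct h U) k cube lam ζ'' κ) M s ρ X x₁ x₂‖ = ‖regC Λ (prec49 a c U k cube lam ζ'' κ) M s ρ X x₁ x₂‖ := by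
  obtain ⟨h1, h2⟩ := locC_regC_prec49_gaugeAct hk hc ha h U hcube lam ζ'' κ Λ hγ hc₀ hδ hA hM hMR hMθ ρ X x₁ x₂
  rw [h1, h2, norm_phase_sandwich, norm_phase_sandwich]
  exact ⟨rfl, rfl⟩

end Model

/-! ## §7 Consequence: the fluctuation-field bilinear forms built on the walk pieces are GAUGE INVARIANT (why p. 265 records the covariance) -/

section Forms

variable {k : ℕ} {ι : Type*} [Fintype ι] {a c : ℝ}

/-- kernel: a kernel transforming «by the difference of the gauge transformation between the points of evaluation» gives a bilinear form
invariant under the simultaneous phase rotation of the two fields. [folklore] (bookkeeping for Bałaban–Imbrie–Jaffe, CMP **114**, p. 265) -/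
private theorem form_invariant {S : Type*} (Λ : Finset S) (d : S → ℂ) (hd : ∀ x ∈ Λ, ‖d x‖ = 1) (K K' : ↥Λ → ↥Λ → ℂ)
    (hK : ∀ x₁ x₂, K' x₁ x₂ = d x₁.1 * K x₁ x₂ * conj (d x₂.1)) (ψ φ : ↥Λ → ℂ) :
    ∑ x₁, ∑ x₂, conj (d x₁.1 * ψ x₁) * K' x₁ x₂ * (d x₂.1 * φ x₂) = ∑ x₁, ∑ x₂, conj (ψ x₁) * K x₁ x₂ * φ x₂ := by
  refine Finset.sum_congr rfl fun x₁ _ => Finset.sum_congr rfl fun x₂ _ => ?_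
  have h1 : conj (d x₁.1) * d x₁.1 = 1 := by
    rw [← Complex.normSq_eq_conj_mul_self, Complex.normSq_eq_norm_sq, hd _ x₁.2]; norm_num
  have h2 : conj (d x₂.1) * d x₂.1 = 1 := by
    rw [← Complex.normSq_eq_conj_mul_self, Complex.normSq_eq_norm_sq, hd _ x₂.2]; norm_num
  rw [hK, map_mul]
  calc conj (d x₁.1) * conj (ψ x₁) * (d x₁.1 * K x₁ x₂ * conj (d x₂.1)) * (d x₂.1 * φ x₂)
      = (conj (d x₁.1) * d x₁.1) * (conj (d x₂.1) * d x₂.1) * (conj (ψ x₁) * K x₁ x₂ * φ x₂) := by ring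
    _ = conj (ψ x₁) * K x₁ x₂ * φ x₂ := by rw [h1, h2, one_mul, one_mul]

/-- **GAUGE INVARIANCE OF THE FORMS `⟨ψ, C^ℂ_ω(u)φ⟩_Λ` AND `⟨ψ, C^{(k)}_Λ(u)φ⟩_Λ`** — the use of the p. 265 covariance (cf. p. 287 *"all terms
are gauge invariant"*): under `(u, ψ, φ) ↦ (u^h, hψ, hφ)` (the Higgs-type fields on `Λ ⊆ T₁^{(k)}` rotated by the phases `h(cornerIter k x)`,
[BalabanImbrieJaffe1985] (2.7)–(2.8)) the bilinear forms of every walk term and of the covariance itself are unchanged; no (5.6).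
[cite: BalabanImbrieJaffe1988, p.265 (gauge covariance of the random walk operators), (2.42) p.264] -/
theorem form_walkC_prec49_gaugeAct (hk : j + k + 1 ≤ P.m + P.K) (hc : c ≠ 0) (ha : 0 < a) (h : GaugeTransf P j U1) (U : GaugeField P j U1)
    {cube : ι → Finset (Balaban1983to89.Site P j)} (hcube : ∀ α, IsBlockUnion k (cube α))
    (lam : ι → Balaban1983to89.Site P j → Balaban1983to89.Site P j → ℝ) (ζ'' : Balaban1983to89.Site P j → Balaban1983to89.Site P j → ℝ) (κ : ℝ)
    (Λ : Finset (Balaban1983to89.Site P (j + k))) (M : ℕ) (ω : Walk ↥(labels M (chartSet Λ))) (ψ φ : ↥Λ → ℂ) :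
    (∑ x₁, ∑ x₂, conj (toC (h (cornerIter k x₁.1)) * ψ x₁) * walkC Λ (prec49 a c (gaugeAct h U) k cube lam ζ'' κ) M ω x₁ x₂ *
        (toC (h (cornerIter k x₂.1)) * φ x₂) =
      ∑ x₁, ∑ x₂, conj (ψ x₁) * walkC Λ (prec49 a c U k cube lam ζ'' κ) M ω x₁ x₂ * φ x₂) ∧
    (∑ x₁, ∑ x₂, conj (toC (h (cornerIter k x₁.1)) * ψ x₁) * (compress Λ (prec49 a c (gaugeAct h U) k cube lam ζ'' κ))⁻¹ x₁ x₂ *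
        (toC (h (cornerIter k x₂.1)) * φ x₂) =
      ∑ x₁, ∑ x₂, conj (ψ x₁) * (compress Λ (prec49 a c U k cube lam ζ'' κ))⁻¹ x₁ x₂ * φ x₂) :=
  ⟨form_invariant Λ _ (norm_phase h Λ) _ _ (fun x₁ x₂ => walkC_prec49_gaugeAct hk hc ha h U hcube lam ζ'' κ Λ M ω x₁ x₂) ψ φ,
    form_invariant Λ _ (norm_phase h Λ) _ _ (fun x₁ x₂ => inv_compress_prec49_gaugeAct_apply hk hc ha h U hcube lam ζ'' κ Λ x₁ x₂) ψ φ⟩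

/-- **GAUGE INVARIANCE OF THE FORMS `⟨ψ, C^ℂ_{Λ,loc}(u)φ⟩_Λ` AND `⟨ψ, C^ℂ_{Λ,X}(u)φ⟩_Λ`** (under [6] (5.6) for the charted `H(u)|_Λ` + p13's cube
conditions): the localized (2.43) and the `X`-indexed (2.44) pieces of the fluctuation covariance give gauge-invariant quadratic forms.
[cite: BalabanImbrieJaffe1988, p.265 (gauge covariance of the random walk operators), (2.43)–(2.44) p.264] -/
theorem form_locC_regC_prec49_gaugeAct (hk : j + k + 1 ≤ P.m + P.K) (hc : c ≠ 0) (ha : 0 < a) (h : GaugeTransf P j U1) (U : GaugeField P j U1)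
    {cube : ι → Finset (Balaban1983to89.Site P j)} (hcube : ∀ α, IsBlockUnion k (cube α))
    (lam : ι → Balaban1983to89.Site P j → Balaban1983to89.Site P j → ℝ) (ζ'' : Balaban1983to89.Site P j → Balaban1983to89.Site P j → ℝ) (κ : ℝ)
    (Λ : Finset (Balaban1983to89.Site P (j + k))) {M : ℕ} {γ₀ c₀ δ₀ : ℝ} (hγ : 0 < γ₀) (hc₀ : 0 ≤ c₀) (hδ : 0 < δ₀)
    (hA : B4.Hyp56 (chartSet Λ) (reOp Λ (prec49 a c U k cube lam ζ'' κ)) γ₀ c₀ δ₀) (hM : 5 ≤ M)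
    (hMR : kR P.d 2 γ₀ c₀ δ₀ < M) (hMθ : thetaConst P.d 2 γ₀ c₀ δ₀ < M) (ρ : ℝ) {s : ℕ} (X : Finset (Cubes M s (chartSet Λ))) (ψ φ : ↥Λ → ℂ) :
    (∑ x₁, ∑ x₂, conj (toC (h (cornerIter k x₁.1)) * ψ x₁) * locC Λ (prec49 a c (gaugeAct h U) k cube lam ζ'' κ) M ρ x₁ x₂ *
        (toC (h (cornerIter k x₂.1)) * φ x₂) =
      ∑ x₁, ∑ x₂, conj (ψ x₁) * locC Λ (prec49 a c U k cube lam ζ'' κ) M ρ x₁ x₂ * φ x₂) ∧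
    (∑ x₁, ∑ x₂, conj (toC (h (cornerIter k x₁.1)) * ψ x₁) * regC Λ (prec49 a c (gaugeAct h U) k cube lam ζ'' κ) M s ρ X x₁ x₂ *
        (toC (h (cornerIter k x₂.1)) * φ x₂) =
      ∑ x₁, ∑ x₂, conj (ψ x₁) * regC Λ (prec49 a c U k cube lam ζ'' κ) M s ρ X x₁ x₂ * φ x₂) :=
  ⟨form_invariant Λ _ (norm_phase h Λ) _ _
      (fun x₁ x₂ => (locC_regC_prec49_gaugeAct hk hc ha h U hcube lam ζ'' κ Λ hγ hc₀ hδ hA hM hMR hMθ ρ X x₁ x₂).1) ψ φ,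
    form_invariant Λ _ (norm_phase h Λ) _ _
      (fun x₁ x₂ => (locC_regC_prec49_gaugeAct hk hc ha h U hcube lam ζ'' κ Λ hγ hc₀ hδ hA hM hMR hMθ ρ X x₁ x₂).2) ψ φ⟩

end Forms

end

end Literature.MathematicalPhysics.QuantumFieldTheory.BalabanImbrieJaffe1984to88.BIJ88Claim265GaugeTransfTorus
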